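import Mathlib
import Summits.CriticalPhenomena.CardyFormulaZ2.Theorems.CardyMagicRigidityDefs
import Summits.CriticalPhenomena.CardyFormulaZ2.Theorems.CardyMagicRigidityNestingRigiditySoftMachineLimit
import Summits.CriticalPhenomena.CardyFormulaZ2.Theorems.CardyMagicRigidityNestingRigiditySoftMachineSiteWindows
import Summits.CriticalPhenomena.CardyFormulaZ2.Theorems.CardyMagicRigidityNestingRigiditySoftMachineMeasurable
import HarnessLib

/-!
# Soft machine, brick 8: the UNCONDITIONAL sequential `d_CN`-precompactness of site-`𝕋` (T1m for `tEns`)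

Crux `Summit.CriticalPhenomena.CardyFormulaZ2.Theses.CardyMagicRigidity.NestingRigidity`
(stmt-CriticalPhenomena-4835), line `positive-cone-weight-doubling`, registered stub `stub_tamePrecompactness :
TamePrecompact zEns ∧ TamePrecompact tEns`.  This file applies THE SOFT MACHINE (`softMachine_limit`, brick 6) to
critical site percolation on `δ𝕋`: the typed disc-windowed interface-loop collections of brick 3 are tight in the
Aizenman–Burchard space (`softMachine_isTightLaws_siteWinColl`, from the LANDED multiple-traversal estimate
`triSitePercolation_exists_loop_hasTraversals_le`), compact sets of loops at positive mesh, measurable with finite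
range, and faithful to the whole-plane typed configuration `siteLoopConfig δ ω = tEns.X δ ω` inside `B(0, m + 2)`
(window radius `m + 3`, mesh `δ ≤ 1`).  Hence (`softMachine_precompactLaw_tEns`, registered anchor):

  for every mesh sequence `δₖ → 0⁺` there are a subsequence `φ` and a presentation `X : [0,1] → C` on
  `([0,1], Leb)` with MEASURABLE hitting events — hence measurable closeness events against BOTH lattice
  ensembles at every positive mesh (brick 7) — such that `d_CN((P_{1/2}, tEns.X (δ_{φ k})), (Leb, X)) → 0`.

No named fact is used: in particular NOT the Camia–Newman existence theorem `exists_isFullPlaneCNLLaw` (on which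
the previous `precompactLaw_tEns_of_exists_isFullPlaneCNLLaw` of `…PrecompactnessReduction` rested) — uniqueness
of the limit is irrelevant for a SUBSEQUENTIAL limit.
-/

noncomputable section

open MeasureTheory Set Filter Metric TopologicalSpace Function
open scoped Topology ENNReal NNReal unitInterval

namespace Summit.CriticalPhenomena.CardyFormulaZ2.Cruxes.NestingRigidity.PositiveConeWeightDoubling

open Literature.Probability.RandomPlanarGeometry Literature.Probability.Percolation
  Literature.Probability.LatticeModels
open Summit.CriticalPhenomena.CardyFormulaZ2.Cruxes.NestingRigidity.RingCloudTomography

/-- From a tight family of laws indexed by the mesh to the uniform preimage form along a sequence of meshes in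
`(0, 1]`, for measurable maps. -/
theorem SoftMachine.exists_isCompact_preimage_le_of_isTightLaws {Ω Y : Type*} [MeasurableSpace Ω]
    [TopologicalSpace Y] [MeasurableSpace Y] [OpensMeasurableSpace Y] [T2Space Y] {P : Measure Ω}
    {L : ℝ → Ω → Y} (h : IsTightLaws fun δ ↦ P.map (L δ)) {δs : ℕ → ℝ} (hδs : ∀ k, δs k ∈ Ioc (0 : ℝ) 1)
    (hmeas : ∀ k, Measurable (L (δs k))) {ε : ℝ≥0∞} (hε : 0 < ε) :
    ∃ K : Set Y, IsCompact K ∧ ∀ k, P (L (δs k) ⁻¹' Kᶜ) ≤ ε := by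
  obtain ⟨K, hK, hKμ⟩ := (isTightMeasureSet_iff_exists_isCompact_measure_compl_le.1 h) ε hε
  refine ⟨K, hK, fun k ↦ ?_⟩
  have hle := hKμ (P.map (L (δs k))) ⟨δs k, hδs k, rfl⟩
  rwa [Measure.map_apply (hmeas k) hK.isClosed.measurableSet.compl] at hle

/-- **THE SOFT MACHINE APPLIED TO SITE-`𝕋` along a mesh sequence in `(0, 1]`**: a subsequence and a presentation
`X` on `([0,1], Leb)` with measurable hitting events and `d_CN((P_{1/2}, siteLoopConfig (δ (φ k))), (Leb, X)) → 0`. -/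
theorem SoftMachine.exists_subseq_limit_siteLoopConfig (δs : ℕ → ℝ) (hδs : ∀ k, δs k ∈ Ioc (0 : ℝ) 1) :
    ∃ φ : ℕ → ℕ, StrictMono φ ∧ ∃ X : unitInterval → LoopConfig ℂ,
      (∀ (i : Fin 2) (Q : Set (UnbasedLoop ℂ)), IsClosed Q → MeasurableSet {s | ∃ u ∈ (X s).F i, u ∈ Q}) ∧
      Tendsto (fun k ↦ LoopConfig.cnLawEDist (triSitePercolation half) (siteLoopConfig (δs (φ k))) volume X)
        atTop (𝓝 0) := by
  haveI := standardBorelSpace_siteConfig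
  -- the typed windowed collections, window `m` = disc of radius `m + 3`
  set Ws : ℕ → ℕ → Fin 2 → SiteConfig (Site 2) → LoopSpace ℂ := fun k m i ω ↦ Closeds.closure
    {c : CurveClass ℂ | ∃ (f : HexVertex) (γ : hexGraph.Walk f f),
      IsSiteInterfaceLoop (ω ∩ triMeshVertices (ball (0 : ℂ) ((m : ℝ) + 3)) (δs k)) γ ∧
        (i = 1 ↔ 0 < shoelace (γ.support.map hexCenter)) ∧ c = siteLoopCurve (δs k) γ} with hWs
  have hpos : ∀ k, 0 < δs k := fun k ↦ (hδs k).1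
  refine softMachine_limit (SiteConfig (Site 2)) (triSitePercolation half) (fun k ↦ siteLoopConfig (δs k)) Ws
    (fun k m i ↦ (SoftMachine.measurable_and_finite_range_siteWinColl (hpos k) ((m : ℝ) + 3) i).1)
    (fun k m i ↦ (SoftMachine.measurable_and_finite_range_siteWinColl (hpos k) ((m : ℝ) + 3) i).2)
    (fun k m i ω ↦ ⟨SoftMachine.isCompact_coe_siteWinColl (hpos k) _ i ω,
      fun c hc ↦ SoftMachine.isLoop_of_mem_siteWinColl hc⟩)
    (fun m i ε hε ↦ ?_) (fun k m i ω u hu hur ↦ ?_) (fun k m i ω c hc hcr ↦ ?_)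
  · -- uniform tightness along the sequence, from the Aizenman–Burchard tightness of brick 3
    exact SoftMachine.exists_isCompact_preimage_le_of_isTightLaws
      (softMachine_isTightLaws_siteWinColl ((m : ℝ) + 3) i) hδs
      (fun k ↦ (SoftMachine.measurable_and_finite_range_siteWinColl (hpos k) ((m : ℝ) + 3) i).1) hε
  · -- faithfulness: whole-plane loops inside `B(0, m + 2)` are members of the window collection
    exact SoftMachine.exists_mem_siteWinColl_of_mem_siteLoopConfig (hpos k).le
      (by linarith [(hδs k).2]) hu hur
  · -- faithfulness: members of the window collection inside `B(0, m + 2)` are whole-plane loops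
    have hc' : c ∈ (Ws k m i ω : Set (CurveClass ℂ)) := hc
    simp only [hWs] at hc'
    rw [SoftMachine.coe_siteWinColl (hpos k)] at hc'
    exact SoftMachine.mk_mem_siteLoopConfig_of_mem_siteWinGen (hpos k).le (by linarith [(hδs k).2]) hc' hcr

/-- **Registered anchor** (`softMachine_precompactLaw_tEns`): the unconditional sequential `d_CN`-precompactness of
the typed loop ensemble of critical site percolation (T1m for `tEns`, see the module docstring): along every mesh
sequence `δₖ → 0⁺` a subsequence converges in DKKMO's coupling distance to a law presented on `([0,1], Leb)` whose
presentation has measurable hitting events, hence measurable closeness events against both lattice ensembles at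
every positive mesh. -/
theorem softMachine_precompactLaw_tEns : ∀ δs : ℕ → ℝ, Tendsto δs atTop (𝓝[>] (0 : ℝ)) →
    ∃ φ : ℕ → ℕ, StrictMono φ ∧ ∃ X : unitInterval → LoopConfig ℂ,
      (∀ (i : Fin 2) (Q : Set (UnbasedLoop ℂ)), IsClosed Q → MeasurableSet {s | ∃ u ∈ (X s).F i, u ∈ Q}) ∧
      (∀ (δ ε : ℝ), 0 < δ → ∀ E' ∈ latticeEnsembles,
        MeasurableSet {p : E'.Ω × unitInterval | LoopConfig.IsClose ε (E'.X δ p.1) (X p.2)}) ∧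
      Tendsto (fun k : ℕ ↦ LoopConfig.cnLawEDist tEns.P (tEns.X (δs (φ k))) volume X) atTop (𝓝 0) := by
  intro δs hδs
  -- eventually the meshes lie in `(0, 1]`
  obtain ⟨k₀, hk₀⟩ := eventually_atTop.1 (hδs.eventually (Ioc_mem_nhdsGT one_pos))
  obtain ⟨φ, hφ, X, hXhit, hconv⟩ :=
    SoftMachine.exists_subseq_limit_siteLoopConfig (fun k ↦ δs (k + k₀)) fun k ↦ hk₀ _ (Nat.le_add_left _ _)
  refine ⟨fun k ↦ φ k + k₀, hφ.add_const k₀, X, hXhit, fun δ ε hδ E' hE' ↦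
    softMachine_measurableSet_isClose_latticeEnsembles E' hE' δ ε hδ unitInterval X hXhit, ?_⟩
  exact hconv

end Summit.CriticalPhenomena.CardyFormulaZ2.Cruxes.NestingRigidity.PositiveConeWeightDoubling

end
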